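import Mathlib
import HarnessLib
import Summits.HubbardSuperconductivity.HubbardSuperconductivity.Theorems.KLProgrammeKLRegimeEngineTowerBlockIncrLevOrientedTalking
import Summits.HubbardSuperconductivity.HubbardSuperconductivity.Theorems.KLProgrammeKLRegimeEngineTowerDoorToKitOriented
import Summits.HubbardSuperconductivity.HubbardSuperconductivity.Theorems.KLProgrammeKLRegimeEngineTowerBlockIncrLevKit

/-!
# LINK-F (i)–(iii) — the ORIENTED levelled norms of a block increment IN KIT FORM, EVERY PRESCRIPTION, floor credit explicit
# (crux K3 ENGINE, stmt-HubbardSuperconductivity-20437 `KLRegimeEngineV17F2`, stub (b) v2, levels package (ℓ), cure of located item #10 «(ℓ)-LEV-ODD»;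
#  cell gate-hubbard-kl, seat hubbard-kl-k3c3-p2 g15 — E1 / p4's LINK-F lane may rename or supersede)

The oriented twin of `…TowerBlockIncrLevKit.klLevNormOf_klTowerIncr_le_kit` / `klTowerBornLev_le_kit`.  The door form
`…TowerBlockIncrLevOrientedTalking.doorSum_klTowerIncr_le_oriented9` (fine talking relation, `c = 9`; (I1)(I2) discharged, (I3) = binders
on an abstract levelled majorant `Nl ≤ Bm·θ^{lumps}`) is composed with the output bridge `klLevNormOf_le_of_forall_doorSum_le`, the
oriented kit majorisation `doorGradedOriented_le_kitStep` (`towerS D τ Bm`, tail `towerV D τ Nt`) and the first-order majorisation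
`doorBinomialPrescribedJ_le_towerFO` (`towerFO D κ² Nt`); per pinned leg `p` the prescribed output set is `J_p = {i ≠ p : Ωe i prescribed}`,
`|J_p| ∈ {F − 1, F}` for `F = levelCount Ωe`, so the parents product is `≤ 27^F` (`card_parentsLeg_klAniso_le`) and the floor credit
`θ^{lumps (1+|J_p|)} ≤ θ^{lumps F}` (`θ ≤ 1`, `lumps_mono`):

* §1 **`klLevNormOf_klTowerIncr_le_kit_oriented9`** — for `1 ≤ d`, `1 ≤ k`, `2 ≤ dk`, `dk ≤ J′`, `Z^K_{Λ_{dk}} ≠ 0`, the unweighted block constants, the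
  (I3) binders, a track-blind tail/first-order majorant `Nt` (`27^c·ε·klTowerMeasLev … (2m) c ≤ Nt m`, `Nt 0 = 0`), graded sizes `Bm ≥ 0`,
  `Bm 0 = 0`, `0 ≤ θ ≤ 1`, kit parameters `τ, ψ` and the kit guard `e·9α/κ²·towerV D τ Nt < 1`: for EVERY `Ωe` of level `F`,
  `klLevNormOf … J′ (2(q+1)) Δ_k Ωe ≤ ε^{2q+1}·(cr·cc^{2q+1}·(27^F·(θ^{lumps F}·S + T)) + cr·cc^{2q+1}·((e²)^{q+2}/2·towerFO D κ² Nt (q+1)))`,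
  `S = Σ_{n∈[2,N₀−1]} e·Φ^{n−1}·ψ^{q+1}·towerS D τ Bm n (q+1)`, `T = ψ^{q+1}·e·V·(ΦV)^{N₀−1}/(1−ΦV)`, `Φ = e·9α/κ²`, `V = towerV D τ Nt`;
* §2 **`klTowerBornLev_le_kit_oriented9`** — at `J′ = dk` the `ciSup` row, every level `F`.
What is left to LINK-F proper (iv): `Bm`, `Nl`, `θ`, `Nt` in FLOOR UNITS (`klLevUnitF`, `2^{−lumps·J}`-keyed) and the division giving the `hstep`
binder of `klTowerBLevF_le_law_of_inputs_base`.  Compositions of landed theorems; nothing about the model is asserted beyond them; nothing asserts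
(ℓ), any stub, K3 or superconductivity.
References: BGM 2006 §2.7 (2.71a), §2.8 (2.76)–(2.84), (2.88)–(2.90), (2.97)–(2.98), §3 (3.2)–(3.8), App. A4 [cite: BenfattoGiulianiMastropietro2006].
-/

noncomputable section

namespace Summit.HubbardSuperconductivity.HubbardSuperconductivity.Theorems.EngineV8

set_option linter.dupNamespace false -- summit = problem name (single-conjunct summit), D-0017

open Classical
open Real Finset Literature.MathematicalPhysics.QuantumLattice Literature.Probability.LatticeModels GrassmannAlgebra
open Literature.MathematicalPhysics.QuantumLattice.FermiRG Literature.MathematicalPhysics.QuantumLattice.FermiRG.BGM2006Routing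
open Summit.HubbardSuperconductivity.HubbardSuperconductivity.Theorems.KLProgrammeLegKernels
open Summit.HubbardSuperconductivity.HubbardSuperconductivity.Theorems.KLRegimeSplit
open Summit.HubbardSuperconductivity.HubbardSuperconductivity.Theorems.KLRegimeWick
open Summit.HubbardSuperconductivity.HubbardSuperconductivity.Theorems.TwoPointAssembly
open Summit.HubbardSuperconductivity.HubbardSuperconductivity.Theorems.DispersionFlow
open scoped Nat

variable {L M : ℕ} [NeZero L] [NeZero M]

/-! ## §1 Every levelled norm of `Δ_k` in kit form, floor credit explicit -/

/-- **THE ORIENTED LEVELLED NORMS OF A BLOCK INCREMENT IN KIT FORM, EVERY PRESCRIPTION.**  `1 ≤ d`, `1 ≤ k`, `2 ≤ dk`, `dk ≤ J′`,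
`Z^K_{Λ_{dk}} ≠ 0`; UNWEIGHTED block constants (Gram `κ`, rows/cols `α` of `S(F̃)ᵀΓS(F̃)`, radius `ρ`, overlap `(cr, cc)` of `E(F_{J′})·S(F̃)`,
truncation `N₀ ≥ 2`); the (I3) binders: a levelled majorant `Nl ≥ 0`, antitone in the level, dominating the measured levelled arrays one level
up and the level-`0` position-only row, with `Nl m′ L ≤ Bm m′·θ^{lumps L}` (`L ≥ 1`) for graded sizes `Bm ≥ 0`, `Bm 0 = 0`, `0 ≤ θ ≤ 1`;
a track-blind tail/first-order majorant `Nt ≥ 0`, `Nt 0 = 0`, `27^c·ε·klTowerMeasLev … (2m) c ≤ Nt m`; degree cap `D`; kit parameters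
`τ ≥ (e³κ)², (e²(κ+ρ))²`, `ψ ≥ κ⁻², ρ⁻²`; kit guard `e·9α/κ²·towerV D τ Nt < 1`.  Then for every `Ωe` (`F := levelCount Ωe`):
`klLevNormOf … J′ (2(q+1)) Δ_k Ωe ≤ ε^{2q+1}·(cr·cc^{2q+1}·(27^F·(θ^{lumps F}·S + T)) + cr·cc^{2q+1}·((e²)^{q+2}/2·towerFO D κ² Nt (q+1)))`. -/
theorem klLevNormOf_klTowerIncr_le_kit_oriented9 {β : ℝ} (hβ : 0 < β) (U μ : ℝ) (K : TrigPolyC4v) {d k J' : ℕ} (hd : 1 ≤ d)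
    (hk : 1 ≤ k) (hJ' : d * k ≤ J') (hdk : 2 ≤ d * k) (hZ : hubbardEffPartitionFnCT L M β U μ 0 K (klScale klE0 (d * k)) ≠ 0)
    {κ : ℝ} (hκ : 0 < κ)
    (hGB : IsGramBoundedR ((sectorSubMatrix L M β (bgmFatMultiplier L M klE0 β (nambuXiCT L μ K) (d * k - 1))).transpose *
      hubbardCovSliceCT L M β μ 0 K (klScale klE0 (d * (k + 1))) (klScale klE0 (d * k)) *
        sectorSubMatrix L M β (bgmFatMultiplier L M klE0 β (nambuXiCT L μ K) (d * k - 1))) κ)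
    {α : ℝ} (hα : 0 < α)
    (hrow : ∀ X, ∑ Y, ‖((sectorSubMatrix L M β (bgmFatMultiplier L M klE0 β (nambuXiCT L μ K) (d * k - 1))).transpose *
        hubbardCovSliceCT L M β μ 0 K (klScale klE0 (d * (k + 1))) (klScale klE0 (d * k)) *
          sectorSubMatrix L M β (bgmFatMultiplier L M klE0 β (nambuXiCT L μ K) (d * k - 1))) X Y‖ ≤ α)
    (hcol : ∀ Y, ∑ X, ‖((sectorSubMatrix L M β (bgmFatMultiplier L M klE0 β (nambuXiCT L μ K) (d * k - 1))).transpose *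
        hubbardCovSliceCT L M β μ 0 K (klScale klE0 (d * (k + 1))) (klScale klE0 (d * k)) *
          sectorSubMatrix L M β (bgmFatMultiplier L M klE0 β (nambuXiCT L μ K) (d * k - 1))) X Y‖ ≤ α)
    {ρ : ℝ} (hρ : 0 < ρ)
    {cr cc : ℝ} (hcr0 : 0 ≤ cr) (hcc0 : 0 ≤ cc)
    (hrow' : ∀ X'', ∑ X', ‖(sectorAnalysisMatrix L M β (klAnisoFamily L M β μ K klE0 J') *
        sectorSubMatrix L M β (bgmFatMultiplier L M klE0 β (nambuXiCT L μ K) (d * k - 1))) X'' X'‖ ≤ cr)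
    (hcol' : ∀ X', ∑ X'', ‖(sectorAnalysisMatrix L M β (klAnisoFamily L M β μ K klE0 J') *
        sectorSubMatrix L M β (bgmFatMultiplier L M klE0 β (nambuXiCT L μ K) (d * k - 1))) X'' X'‖ ≤ cc)
    {N₀ : ℕ} (hN₀ : 2 ≤ N₀)
    (Nl : ℕ → ℕ → ℝ) (hNl0 : ∀ m' Lv, 0 ≤ Nl m' Lv) (hanti : ∀ m' Lv Lv', Lv ≤ Lv' → Nl m' Lv' ≤ Nl m' Lv)
    (hBN : ∀ m' Fc, imagTimeWeight β M * klTowerMeasLev L M β U μ K d k (2 * (m' + 1)) Fc ≤ Nl (m' + 1) (Fc + 1))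
    (hB'N0 : ∀ m', imagTimeWeight β M * ((Fintype.card (SectorLeg (sectorCount (d * k - 1))) : ℝ) *
      klTowerMeasLev L M β U μ K d k (2 * (m' + 1)) 0) ≤ Nl (m' + 1) 0)
    (Bm : ℕ → ℝ) (hBm0 : ∀ m', 0 ≤ Bm m') (hBm00 : Bm 0 = 0) {θ : ℝ} (hθ0 : 0 ≤ θ) (hθ1 : θ ≤ 1)
    (hdom : ∀ m' Lv, 1 ≤ Lv → Nl m' Lv ≤ Bm m' * θ ^ lumps Lv)
    {Nt : ℕ → ℝ} (hNt0 : ∀ m, 0 ≤ Nt m) (hNt00 : Nt 0 = 0)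
    (hNtB : ∀ m c, (27 : ℝ) ^ c * (imagTimeWeight β M * klTowerMeasLev L M β U μ K d k (2 * m) c) ≤ Nt m)
    {D : ℕ} (hD : Fintype.card (SpaceTimeIdx L M × SectorLeg (sectorCount (d * k - 1))) / 2 ≤ D)
    {τ ψ : ℝ} (hτ1 : (exp 3 * κ) ^ 2 ≤ τ) (hτ2 : (exp 2 * (κ + ρ)) ^ 2 ≤ τ) (hψ1 : κ⁻¹ ^ 2 ≤ ψ) (hψ2 : ρ⁻¹ ^ 2 ≤ ψ)
    (hguard : exp 1 * (9 * α) / κ ^ 2 * towerV D τ Nt < 1) (q : ℕ) (Ωe : Fin (2 * q + 1 + 1) → Option (SectorLeg (sectorCount J'))) :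
    klLevNormOf L M β μ K J' (2 * q + 1 + 1) (klTowerIncr L M β U μ K d k) Ωe ≤
      imagTimeWeight β M ^ (2 * q + 1) *
        (cr * cc ^ (2 * q + 1) * ((27 : ℝ) ^ levelCount Ωe *
            (θ ^ lumps (levelCount Ωe) *
                ∑ n ∈ Icc 2 (N₀ - 1), exp 1 * (exp 1 * (9 * α) / κ ^ 2) ^ (n - 1) * ψ ^ (q + 1) * towerS D τ Bm n (q + 1) +
              ψ ^ (q + 1) * (exp 1 * towerV D τ Nt * (exp 1 * (9 * α) / κ ^ 2 * towerV D τ Nt) ^ (N₀ - 1) /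
                (1 - exp 1 * (9 * α) / κ ^ 2 * towerV D τ Nt)))) +
          cr * cc ^ (2 * q + 1) * (exp 2 ^ (q + 2) / 2 * towerFO D (κ ^ 2) Nt (q + 1))) := by
  have hβ' : β ≠ 0 := hβ.ne'
  have hkJ : d * k - 1 ≤ J' := by omega
  have hε : 0 ≤ imagTimeWeight β M := imagTimeWeight_nonneg hβ.le M
  have h27 : (0 : ℝ) ≤ 27 := by norm_num
  have h9 : (((9 : ℕ) : ℝ)) = 9 := by norm_num
  have h9α : α ≤ ((9 : ℕ) : ℝ) * α := by rw [h9]; linarith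
  -- abbreviations for the kit terms and their signs
  set Φ := exp 1 * (9 * α) / κ ^ 2 with hΦ
  set V := towerV D τ Nt with hV
  set FO := towerFO D (κ ^ 2) Nt (q + 1) with hFO
  set S := ∑ n ∈ Icc 2 (N₀ - 1), exp 1 * Φ ^ (n - 1) * ψ ^ (q + 1) * towerS D τ Bm n (q + 1) with hS
  set T := ψ ^ (q + 1) * (exp 1 * V * (Φ * V) ^ (N₀ - 1) / (1 - Φ * V)) with hT
  set F := levelCount Ωe with hFdef
  have hτ0 : 0 ≤ τ := le_trans (by positivity) hτ1
  have hψ0 : 0 ≤ ψ := le_trans (by positivity) hψ1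
  have hΦ0 : 0 ≤ Φ := by rw [hΦ]; positivity
  have hV0 : 0 ≤ V := towerV_nonneg (D := D) hτ0 hNt0
  have hFO0 : 0 ≤ FO := towerFO_nonneg (by positivity) hNt0 _
  have hS0 : 0 ≤ S := sum_nonneg fun n _ => by
    have := towerS_nonneg (D := D) hτ0 hBm0 n (q + 1); positivity
  have hT0 : 0 ≤ T := mul_nonneg (pow_nonneg hψ0 _) (div_nonneg (by positivity) (sub_nonneg.2 hguard.le))
  have hcrcc : 0 ≤ cr * cc ^ (2 * q + 1) := by positivity
  have hC0 : 0 ≤ imagTimeWeight β M ^ (2 * q + 1) *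
      (cr * cc ^ (2 * q + 1) * ((27 : ℝ) ^ F * (θ ^ lumps F * S + T)) + cr * cc ^ (2 * q + 1) * (exp 2 ^ (q + 2) / 2 * FO)) := by
    positivity
  -- the input arrays
  set B : ℕ → ℕ → ℝ := fun m c => klTowerMeasLev L M β U μ K d k (2 * m) c with hB
  have hB0 : ∀ m c, 0 ≤ B m c := fun m c => klTowerMeasLev_nonneg hβ.le U μ K d k _ c
  have hNtB0 : ∀ m, imagTimeWeight β M * B m 0 ≤ Nt m := fun m => by simpa using hNtB m 0
  -- the door guard from the kit guard
  have hnV : normV (SpaceTimeIdx L M × SectorLeg (sectorCount (d * k - 1))) κ ρ (fun m' => imagTimeWeight β M * B m' 0) ≤ V :=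
    (normV_mono hκ.le hρ.le hNtB0).trans
      ((normV_le_towerV hκ.le hρ.le hNt0 hNt00 hD).trans (towerV_mono (by positivity) hτ2 hNt0 fun _ => le_rfl))
  have hθV : Real.exp 1 * α * normV (SpaceTimeIdx L M × SectorLeg (sectorCount (d * k - 1))) κ ρ
      (fun m' => imagTimeWeight β M * klTowerMeasLev L M β U μ K d k (2 * m') 0) / κ ^ 2 < 1 := by
    have hn0 : 0 ≤ normV (SpaceTimeIdx L M × SectorLeg (sectorCount (d * k - 1))) κ ρ (fun m' => imagTimeWeight β M * B m' 0) :=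
      normV_nonneg hκ.le hρ.le fun m' => mul_nonneg hε (hB0 _ _)
    calc Real.exp 1 * α * normV (SpaceTimeIdx L M × SectorLeg (sectorCount (d * k - 1))) κ ρ
          (fun m' => imagTimeWeight β M * B m' 0) / κ ^ 2
        = exp 1 / κ ^ 2 * (α * normV (SpaceTimeIdx L M × SectorLeg (sectorCount (d * k - 1))) κ ρ
            (fun m' => imagTimeWeight β M * B m' 0)) := by ring
      _ ≤ exp 1 / κ ^ 2 * ((9 * α) * V) :=
          mul_le_mul_of_nonneg_left (mul_le_mul (by linarith) hnV hn0 (by positivity)) (by positivity)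
      _ = Φ * V := by rw [hΦ]; ring
      _ < 1 := hguard
  -- the output bridge: every door-form sum is bounded by the kit right side
  refine klLevNormOf_le_of_forall_doorSum_le hβ.le μ K J' (klTowerIncr L M β U μ K d k) Ωe hC0 fun p s x => ?_
  set J : Finset (Fin (2 * q + 1 + 1)) := univ.filter (fun i : Fin (2 * q + 1 + 1) => (Ωe i).isSome ∧ i ≠ p) with hJdef
  have hp : p ∉ J := by rw [hJdef, mem_filter]; exact fun h => h.2.2 rfl
  -- `|J_p| ∈ {F − 1, F}`
  have hJF : J.card ≤ F := by
    rw [hFdef, levelCount, hJdef]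
    exact card_le_card (monotone_filter_right _ fun i _ hi => hi.1)
  have hFJ : F ≤ 1 + J.card := by
    rw [hFdef, levelCount, hJdef]
    have hsub : (univ.filter fun i : Fin (2 * q + 1 + 1) => (Ωe i).isSome) ⊆
        insert p (univ.filter fun i : Fin (2 * q + 1 + 1) => (Ωe i).isSome ∧ i ≠ p) := by
      intro i hi
      rw [mem_insert, mem_filter]
      rw [mem_filter] at hi
      by_cases hip : i = p
      · exact Or.inl hip
      · exact Or.inr ⟨mem_univ _, hi.2, hip⟩
    exact (card_le_card hsub).trans ((card_insert_le _ _).trans (by omega))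
  -- the door form at this `(p, J, τ″, w″)`
  have hdoor := doorSum_klTowerIncr_le_oriented9 (L := L) (M := M) hβ U μ K hd hk hJ' hdk hZ hκ hGB hα hrow hcol hρ hcc0 hrow' hcol'
    hN₀ Nl hNl0 hanti hBN hB'N0 Bm hBm0 hθ0 hdom hθV p J hp (fun j => (Ωe j).getD s) (x, s)
  -- (iii) the oriented bracket under the kit step, floor credit `θ^{lumps (1+|J|)}` in front
  have hguard' : exp 1 * (((9 : ℕ) : ℝ) * α) / κ ^ 2 * towerV D τ Nt < 1 := by rw [h9]; exact hguard
  have hkit := doorGradedOriented_le_kitStep (Γ := SpaceTimeIdx L M × SectorLeg (sectorCount (d * k - 1))) (Jt := ↥J)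
    hκ hρ hα.le h9α hε (θL := θ ^ lumps (1 + J.card)) (pow_nonneg hθ0 _) hBm0 hBm00 (B := B) (fun m => hB0 m 0) hNt0 hNt00 hNtB0
    hD hN₀ (m := 2 * q + 1) (p := q + 1) (by ring) hτ1 hτ2 hψ1 hψ2 hguard'
  rw [Fintype.card_coe, h9] at hkit
  -- floor credit and parents product monotonised to the level `F`
  have hθF : θ ^ lumps (1 + J.card) ≤ θ ^ lumps F := pow_le_pow_of_le_one hθ0 hθ1 (lumps_mono hFJ)
  have hGT := hkit.trans (add_le_add (mul_le_mul_of_nonneg_right hθF hS0) (le_refl T))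
  have hpar : (∏ j ∈ J, (((univ.filter fun ℓ' : SectorLeg (sectorCount (d * k - 1)) =>
      (∃ q' : FreqMomentum L M, klAnisoFamily L M β μ K klE0 J' ((Ωe j).getD s).1.1 q' ≠ 0 ∧
        bgmFatMultiplier L M klE0 β (nambuXiCT L μ K) (d * k - 1) ℓ'.1.1 q' ≠ 0) ∧
      ℓ'.1.2 = ((Ωe j).getD s).1.2 ∧ ℓ'.2 = ((Ωe j).getD s).2).card : ℕ) : ℝ)) ≤ (27 : ℝ) ^ F := by
    calc _ ≤ ∏ _j ∈ J, (27 : ℝ) := prod_le_prod (fun j _ => Nat.cast_nonneg _) fun j _ => by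
            convert card_parentsLeg_klAniso_le β μ K hkJ ((Ωe j).getD s) using 3
      _ = (27 : ℝ) ^ J.card := prod_const _
      _ ≤ (27 : ℝ) ^ F := pow_le_pow_right₀ (by norm_num) hJF
  have hP0 : 0 ≤ ∏ j ∈ J, (((univ.filter fun ℓ' : SectorLeg (sectorCount (d * k - 1)) =>
      (∃ q' : FreqMomentum L M, klAnisoFamily L M β μ K klE0 J' ((Ωe j).getD s).1.1 q' ≠ 0 ∧
        bgmFatMultiplier L M klE0 β (nambuXiCT L μ K) (d * k - 1) ℓ'.1.1 q' ≠ 0) ∧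
      ℓ'.1.2 = ((Ωe j).getD s).1.2 ∧ ℓ'.2 = ((Ωe j).getD s).2).card : ℕ) : ℝ) := prod_nonneg fun j _ => Nat.cast_nonneg _
  have hPGT := (mul_le_mul_of_nonneg_left hGT hP0).trans
    (mul_le_mul_of_nonneg_right hpar (add_nonneg (mul_nonneg (pow_nonneg hθ0 _) hS0) hT0))
  -- first order, `J`-free
  have hfo := doorBinomialPrescribedJ_le_towerFO (κ := κ) (ρc := (27 : ℝ)) (ε := imagTimeWeight β M) hκ.le h27 hε hB0 (N := Nt)
    hNtB hD q J
  -- assemble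
  have hfin := hdoor.trans (add_le_add (mul_le_mul_of_nonneg_left hPGT hcrcc) (mul_le_mul_of_nonneg_left hfo hcrcc))
  exact mul_le_mul_of_nonneg_left hfin (pow_nonneg hε _)

/-! ## §2 The born levelled arrays in kit form, floor credit explicit -/

/-- **THE ORIENTED BORN LEVELLED ARRAYS OF A BLOCK INCREMENT IN KIT FORM, EVERY LEVEL** (the `hstep` row of the floor-keyed law, model half,
before the floor-units dictionary).  At the born family `J′ = dk` and under the binders of `klLevNormOf_klTowerIncr_le_kit_oriented9`, for every
level `F`: `klTowerBornLev … d k (2(q+1)) F ≤ ε^{2q+1}·(cr·cc^{2q+1}·(27^F·(θ^{lumps F}·S + T)) + cr·cc^{2q+1}·((e²)^{q+2}/2·towerFO))`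
(the `ciSup` row; an empty level gives `0 ≤` the same). -/
theorem klTowerBornLev_le_kit_oriented9 {β : ℝ} (hβ : 0 < β) (U μ : ℝ) (K : TrigPolyC4v) {d k : ℕ} (hd : 1 ≤ d) (hk : 1 ≤ k)
    (hdk : 2 ≤ d * k) (hZ : hubbardEffPartitionFnCT L M β U μ 0 K (klScale klE0 (d * k)) ≠ 0)
    {κ : ℝ} (hκ : 0 < κ)
    (hGB : IsGramBoundedR ((sectorSubMatrix L M β (bgmFatMultiplier L M klE0 β (nambuXiCT L μ K) (d * k - 1))).transpose *
      hubbardCovSliceCT L M β μ 0 K (klScale klE0 (d * (k + 1))) (klScale klE0 (d * k)) *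
        sectorSubMatrix L M β (bgmFatMultiplier L M klE0 β (nambuXiCT L μ K) (d * k - 1))) κ)
    {α : ℝ} (hα : 0 < α)
    (hrow : ∀ X, ∑ Y, ‖((sectorSubMatrix L M β (bgmFatMultiplier L M klE0 β (nambuXiCT L μ K) (d * k - 1))).transpose *
        hubbardCovSliceCT L M β μ 0 K (klScale klE0 (d * (k + 1))) (klScale klE0 (d * k)) *
          sectorSubMatrix L M β (bgmFatMultiplier L M klE0 β (nambuXiCT L μ K) (d * k - 1))) X Y‖ ≤ α)
    (hcol : ∀ Y, ∑ X, ‖((sectorSubMatrix L M β (bgmFatMultiplier L M klE0 β (nambuXiCT L μ K) (d * k - 1))).transpose *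
        hubbardCovSliceCT L M β μ 0 K (klScale klE0 (d * (k + 1))) (klScale klE0 (d * k)) *
          sectorSubMatrix L M β (bgmFatMultiplier L M klE0 β (nambuXiCT L μ K) (d * k - 1))) X Y‖ ≤ α)
    {ρ : ℝ} (hρ : 0 < ρ)
    {cr cc : ℝ} (hcr0 : 0 ≤ cr) (hcc0 : 0 ≤ cc)
    (hrow' : ∀ X'', ∑ X', ‖(sectorAnalysisMatrix L M β (klAnisoFamily L M β μ K klE0 (d * k)) *
        sectorSubMatrix L M β (bgmFatMultiplier L M klE0 β (nambuXiCT L μ K) (d * k - 1))) X'' X'‖ ≤ cr)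
    (hcol' : ∀ X', ∑ X'', ‖(sectorAnalysisMatrix L M β (klAnisoFamily L M β μ K klE0 (d * k)) *
        sectorSubMatrix L M β (bgmFatMultiplier L M klE0 β (nambuXiCT L μ K) (d * k - 1))) X'' X'‖ ≤ cc)
    {N₀ : ℕ} (hN₀ : 2 ≤ N₀)
    (Nl : ℕ → ℕ → ℝ) (hNl0 : ∀ m' Lv, 0 ≤ Nl m' Lv) (hanti : ∀ m' Lv Lv', Lv ≤ Lv' → Nl m' Lv' ≤ Nl m' Lv)
    (hBN : ∀ m' Fc, imagTimeWeight β M * klTowerMeasLev L M β U μ K d k (2 * (m' + 1)) Fc ≤ Nl (m' + 1) (Fc + 1))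
    (hB'N0 : ∀ m', imagTimeWeight β M * ((Fintype.card (SectorLeg (sectorCount (d * k - 1))) : ℝ) *
      klTowerMeasLev L M β U μ K d k (2 * (m' + 1)) 0) ≤ Nl (m' + 1) 0)
    (Bm : ℕ → ℝ) (hBm0 : ∀ m', 0 ≤ Bm m') (hBm00 : Bm 0 = 0) {θ : ℝ} (hθ0 : 0 ≤ θ) (hθ1 : θ ≤ 1)
    (hdom : ∀ m' Lv, 1 ≤ Lv → Nl m' Lv ≤ Bm m' * θ ^ lumps Lv)
    {Nt : ℕ → ℝ} (hNt0 : ∀ m, 0 ≤ Nt m) (hNt00 : Nt 0 = 0)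
    (hNtB : ∀ m c, (27 : ℝ) ^ c * (imagTimeWeight β M * klTowerMeasLev L M β U μ K d k (2 * m) c) ≤ Nt m)
    {D : ℕ} (hD : Fintype.card (SpaceTimeIdx L M × SectorLeg (sectorCount (d * k - 1))) / 2 ≤ D)
    {τ ψ : ℝ} (hτ1 : (exp 3 * κ) ^ 2 ≤ τ) (hτ2 : (exp 2 * (κ + ρ)) ^ 2 ≤ τ) (hψ1 : κ⁻¹ ^ 2 ≤ ψ) (hψ2 : ρ⁻¹ ^ 2 ≤ ψ)
    (hguard : exp 1 * (9 * α) / κ ^ 2 * towerV D τ Nt < 1) (q F : ℕ) :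
    klTowerBornLev L M β U μ K d k (2 * (q + 1)) F ≤
      imagTimeWeight β M ^ (2 * q + 1) *
        (cr * cc ^ (2 * q + 1) * ((27 : ℝ) ^ F *
            (θ ^ lumps F *
                ∑ n ∈ Icc 2 (N₀ - 1), exp 1 * (exp 1 * (9 * α) / κ ^ 2) ^ (n - 1) * ψ ^ (q + 1) * towerS D τ Bm n (q + 1) +
              ψ ^ (q + 1) * (exp 1 * towerV D τ Nt * (exp 1 * (9 * α) / κ ^ 2 * towerV D τ Nt) ^ (N₀ - 1) /
                (1 - exp 1 * (9 * α) / κ ^ 2 * towerV D τ Nt)))) +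
          cr * cc ^ (2 * q + 1) * (exp 2 ^ (q + 2) / 2 * towerFO D (κ ^ 2) Nt (q + 1))) := by
  have hε : 0 ≤ imagTimeWeight β M := imagTimeWeight_nonneg hβ.le M
  have hτ0 : 0 ≤ τ := le_trans (by positivity) hτ1
  have hψ0 : 0 ≤ ψ := le_trans (by positivity) hψ1
  have hRHS : 0 ≤ imagTimeWeight β M ^ (2 * q + 1) *
      (cr * cc ^ (2 * q + 1) * ((27 : ℝ) ^ F *
          (θ ^ lumps F *
              ∑ n ∈ Icc 2 (N₀ - 1), exp 1 * (exp 1 * (9 * α) / κ ^ 2) ^ (n - 1) * ψ ^ (q + 1) * towerS D τ Bm n (q + 1) +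
            ψ ^ (q + 1) * (exp 1 * towerV D τ Nt * (exp 1 * (9 * α) / κ ^ 2 * towerV D τ Nt) ^ (N₀ - 1) /
              (1 - exp 1 * (9 * α) / κ ^ 2 * towerV D τ Nt)))) +
        cr * cc ^ (2 * q + 1) * (exp 2 ^ (q + 2) / 2 * towerFO D (κ ^ 2) Nt (q + 1))) := by
    have hFO0 : 0 ≤ towerFO D (κ ^ 2) Nt (q + 1) := towerFO_nonneg (by positivity) hNt0 _
    have hS0 : 0 ≤ ∑ n ∈ Icc 2 (N₀ - 1), exp 1 * (exp 1 * (9 * α) / κ ^ 2) ^ (n - 1) * ψ ^ (q + 1) * towerS D τ Bm n (q + 1) :=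
      sum_nonneg fun n _ => by have := towerS_nonneg (D := D) hτ0 hBm0 n (q + 1); positivity
    have hT0 : 0 ≤ ψ ^ (q + 1) * (exp 1 * towerV D τ Nt * (exp 1 * (9 * α) / κ ^ 2 * towerV D τ Nt) ^ (N₀ - 1) /
        (1 - exp 1 * (9 * α) / κ ^ 2 * towerV D τ Nt)) := by
      have hV := towerV_nonneg (D := D) hτ0 hNt0
      exact mul_nonneg (pow_nonneg hψ0 _) (div_nonneg (by positivity) (sub_nonneg.2 hguard.le))
    positivity
  unfold klTowerBornLev
  rcases isEmpty_or_nonempty {Ωe : Fin (2 * (q + 1)) → Option (SectorLeg (sectorCount (d * k))) // levelCount Ωe = F} with h | h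
  · rw [Real.iSup_of_isEmpty]; exact hRHS
  · refine ciSup_le fun Ωe => ?_
    have h1 := klLevNormOf_klTowerIncr_le_kit_oriented9 (L := L) (M := M) hβ U μ K hd hk le_rfl hdk hZ hκ hGB hα hrow hcol hρ hcr0 hcc0
      hrow' hcol' hN₀ Nl hNl0 hanti hBN hB'N0 Bm hBm0 hBm00 hθ0 hθ1 hdom hNt0 hNt00 hNtB hD hτ1 hτ2 hψ1 hψ2 hguard q Ωe.1
    rw [Ωe.2] at h1
    exact h1

end Summit.HubbardSuperconductivity.HubbardSuperconductivity.Theorems.EngineV8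

end
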